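import Summits.KontsevichZagierPeriods.KontsevichZagierPeriods.Theorems.LiftingCriteriaCubeNashNormalFormTame
import Literature.NumberTheory.Transcendental.SemialgebraicMaps
import Mathlib.RingTheory.Polynomial.Resultant.Basic
import Mathlib.Analysis.Analytic.Basic
import Mathlib.Analysis.Calculus.FDeriv.Analytic
import Mathlib.MeasureTheory.Measure.Lebesgue.Basic
import Summits.KontsevichZagierPeriods.KontsevichZagierPeriods.Theorems.LiftingCriteriaCubeNashNormalFormVolumeTwo
import Literature.NumberTheory.Transcendental.SemialgebraicLineDeriv
import Literature.NumberTheory.Transcendental.SemialgebraicAlgebraicScaling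
import Mathlib.Analysis.Analytic.Polynomial
import Mathlib.Analysis.Analytic.Linear
import Mathlib.Algebra.MvPolynomial.Funext
import Summits.KontsevichZagierPeriods.KontsevichZagierPeriods.Theorems.HermiteRigidityGenusTwoCycleTransferPushforwardDimOne

/-!
# Crux `CubeNashNormalForm` (stmt-KontsevichZagierPeriods-3574), line `Sketch` — stub `stub_cubeMonomializationOne`

The base case `E(1)` of the cube-monomialization induction: for a bounded `ℚ`-semialgebraic
`B ⊆ ℝ¹` and finitely many non-zero `Qⱼ ∈ ℚ[X₀]`, take a cylindrical decomposition of the line with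
`ℚ`-semialgebraic cells on which the polynomials describing `B` and all `Qⱼ` have constant sign
(`CylindricalDecomposition.exists_isCylindricalDecomposition_forall_sign_eq`, Basu–Pollack–Roy 2006,
Thm. 5.6). Every cell meeting `B` lies in `B`; the cells of positive length inside `B` are bounded
open intervals `(c, c')` with real-algebraic end points
(`CubeNashNormalFormVolumeTwo.exists_eq_Ioo_of_isCylindricalDecomposition_one`), the remaining cells
are null. The charts are the affine maps `w ↦ c + (c' − c) w` of the open unit interval onto these
cells (analytic, `ℚ`-semialgebraic, injective, Jacobian `c' − c ≠ 0`, reusing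
`HermiteRigidity.GenusTwoCycleTransfer.det_smul_id_fin_one`). Along such a chart
`Qⱼ(c + (c' − c) w)` is a non-zero real polynomial `r(w)` without roots in `(0, 1)` (a root would make
`Qⱼ` vanish on the whole cell by sign-invariance, giving infinitely many roots), and
`r = w^m (1 − w)^{m'} s` with `s` free of roots on `[0, 1]` (root multiplicities at `0` and `1`),
which is the cube-monomial form on the open set `{s(w) ≠ 0} ⊇ [0, 1]`.
[Basu–Pollack–Roy 2006, Thm. 5.6, Cor. 5.7; Bochnak–Coste–Roy 1998, §2.1]
-/

noncomputable section

open Set MeasureTheory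
open Literature.ModelTheory.ExponentialFields (IsSemialgebraic)
open Literature.NumberTheory.Transcendental
open Literature.NumberTheory.Transcendental.KZ

open Literature.ModelTheory.ExponentialFields.CylindricalDecomposition
  (exists_isCylindricalDecomposition_forall_sign_eq)
open Summit.KontsevichZagierPeriods.LiftingCriteria.CubeNashNormalFormVolumeTwo
  (exists_eq_Ioo_of_isCylindricalDecomposition_one)

namespace Summit.KontsevichZagierPeriods.SymplecticScissors.CubeNashNormalFormCubeMonomializationOne

/-! ### The affine charts `x ↦ c + L • x` of `ℝ¹` -/

/-- The affine chart `x ↦ c + L • x` of `ℝ¹` in terms of the single coordinate `x 0`.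
[folklore] -/
theorem affine_eq (c L : ℝ) (x : Fin 1 → ℝ) :
    (fun _ : Fin 1 => c) + L • x = fun _ => c + L * x 0 := by
  funext j
  rw [Pi.add_apply, Pi.smul_apply, smul_eq_mul, Subsingleton.elim j 0]

/-- The affine chart has derivative `L • id` everywhere. [folklore] -/
theorem hasFDerivAt_affine (c L : ℝ) (x : Fin 1 → ℝ) :
    HasFDerivAt (fun x : Fin 1 → ℝ => (fun _ : Fin 1 => c) + L • x)
      (L • ContinuousLinearMap.id ℝ (Fin 1 → ℝ)) x :=
  ((hasFDerivAt_id x).const_smul L).const_add (fun _ => c)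

/-- The affine chart is real analytic everywhere. [folklore] -/
theorem analyticAt_affine (c L : ℝ) (x : Fin 1 → ℝ) :
    AnalyticAt ℝ (fun x : Fin 1 → ℝ => (fun _ : Fin 1 => c) + L • x) x :=
  analyticAt_const.add (analyticAt_id.const_smul (c := L))

/-- The affine chart with `L ≠ 0` is injective. [folklore] -/
theorem affine_injective (c : ℝ) {L : ℝ} (hL : L ≠ 0) :
    Function.Injective (fun x : Fin 1 → ℝ => (fun _ : Fin 1 => c) + L • x) := fun _ _ hxy =>
  smul_right_injective (Fin 1 → ℝ) hL (add_left_cancel hxy)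

/-- The affine chart `w ↦ c + (c' - c) w` maps the open unit interval onto `(c, c')`.
[folklore] -/
theorem image_affine {c c' : ℝ} (h : c < c') :
    (fun x : Fin 1 → ℝ => (fun _ : Fin 1 => c) + (c' - c) • x) ''
        Set.pi Set.univ (fun _ : Fin 1 => Set.Ioo (0:ℝ) 1) = {z | z 0 ∈ Ioo c c'} := by
  have hL : 0 < c' - c := sub_pos.2 h
  ext z
  simp only [mem_image, mem_univ_pi, mem_Ioo, mem_setOf_eq]
  constructor
  · rintro ⟨x, hx, rfl⟩
    have h0 := hx 0
    rw [Pi.add_apply, Pi.smul_apply, smul_eq_mul]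
    constructor <;> nlinarith [h0.1, h0.2]
  · rintro ⟨h1, h2⟩
    refine ⟨fun _ => (z 0 - c) / (c' - c),
      fun _ => ⟨div_pos (by linarith) hL, (div_lt_one hL).2 (by linarith)⟩, ?_⟩
    funext j
    rw [Pi.add_apply, Pi.smul_apply, smul_eq_mul, Subsingleton.elim j 0]
    field_simp
    ring

/-- An affine chart with real-algebraic coefficients is a `ℚ`-semialgebraic map on every
`ℚ`-semialgebraic set. [folklore] -/
theorem isSemialgebraicMapOn_affine {c L : ℝ} (hc : IsAlgebraic ℚ c) (hL : IsAlgebraic ℚ L)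
    {s : Set (Fin 1 → ℝ)} (hs : IsSemialgebraic ℚ s) :
    IsSemialgebraicMapOn ℚ s (fun x : Fin 1 → ℝ => (fun _ : Fin 1 => c) + L • x) :=
  IsSemialgebraicMapOn.of_forall hs fun j =>
    (isSemialgebraicFunOn_const_of_isAlgebraic hs hc).fun_add
      (isSemialgebraicFunOn_const_mul_apply_of_isAlgebraic hs hL j)

/-! ### One-variable polynomials along an affine chart -/

open Polynomial in
/-- The one-variable real polynomial `r = q(c + L X)` obtained from `q ∈ ℚ[X₀]` along the
affine chart `w ↦ c + L w` evaluates as `r(w) = q(c + L w)`. [folklore] -/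
theorem eval_aeval_line (c L : ℝ) (q : MvPolynomial (Fin 1) ℚ) (w : ℝ) :
    (MvPolynomial.aeval (fun _ : Fin 1 => C c + C L * X) q).eval w =
      MvPolynomial.aeval (fun _ : Fin 1 => c + L * w) q := by
  have h := MvPolynomial.comp_aeval_apply (fun _ : Fin 1 => (C c + C L * X : ℝ[X]))
    ((Polynomial.aeval w).restrictScalars ℚ) q
  simp only [AlgHom.coe_restrictScalars', Polynomial.coe_aeval_eq_eval, Polynomial.eval_add,
    Polynomial.eval_mul, Polynomial.eval_C, Polynomial.eval_X] at h
  exact h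

/-- A non-zero polynomial over `ℚ` does not vanish at some real point. [folklore] -/
theorem exists_aeval_ne_zero {q : MvPolynomial (Fin 1) ℚ} (hq : q ≠ 0) :
    ∃ t : Fin 1 → ℝ, MvPolynomial.aeval t q ≠ 0 := by
  by_contra h
  push Not at h
  apply hq
  apply MvPolynomial.map_injective (algebraMap ℚ ℝ) (algebraMap ℚ ℝ).injective
  rw [map_zero]
  apply MvPolynomial.funext
  intro x
  rw [MvPolynomial.eval_map, ← MvPolynomial.aeval_def, h x, map_zero]

open Polynomial in
/-- For `L ≠ 0` and `q ≠ 0` the polynomial `q(c + L X)` is non-zero. [folklore] -/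
theorem aeval_line_ne_zero (c : ℝ) {L : ℝ} (hL : L ≠ 0) {q : MvPolynomial (Fin 1) ℚ}
    (hq : q ≠ 0) : MvPolynomial.aeval (fun _ : Fin 1 => C c + C L * X) q ≠ 0 := by
  obtain ⟨t, ht⟩ := exists_aeval_ne_zero hq
  intro h0
  apply ht
  have h := eval_aeval_line c L q ((t 0 - c) / L)
  rw [h0, Polynomial.eval_zero] at h
  have ht' : (fun _ : Fin 1 => c + L * ((t 0 - c) / L)) = t := by
    funext i
    rw [Subsingleton.elim i 0]
    field_simp
    ring
  rw [ht'] at h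
  exact h.symm

open Polynomial in
/-- **Root multiplicities at the end points.** A non-zero real polynomial `r` without roots in
`(0, 1)` factors as `r(w) = w^m (1 - w)^{m'} s(w)` with `s` free of roots on `[0, 1]`. [folklore] -/
theorem exists_factor_of_forall_eval_ne_zero {r : ℝ[X]} (hr : r ≠ 0)
    (hroot : ∀ w ∈ Ioo (0:ℝ) 1, r.eval w ≠ 0) :
    ∃ (m m' : ℕ) (s : ℝ[X]), (∀ w ∈ Icc (0:ℝ) 1, s.eval w ≠ 0) ∧
      ∀ w, r.eval w = w ^ m * (1 - w) ^ m' * s.eval w := by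
  obtain ⟨s₁, hr₁, hndvd₁⟩ := r.exists_eq_pow_rootMultiplicity_mul_and_not_dvd hr 0
  generalize r.rootMultiplicity 0 = m at hr₁
  subst hr₁
  have hs₁ : s₁ ≠ 0 := right_ne_zero_of_mul hr
  obtain ⟨s₂, hs₁₂, hndvd₂⟩ :=
    s₁.exists_eq_pow_rootMultiplicity_mul_and_not_dvd hs₁ 1
  generalize s₁.rootMultiplicity 1 = m' at hs₁₂
  subst hs₁₂
  have h0 : s₂.eval 0 ≠ 0 := fun h => hndvd₁ ((dvd_iff_isRoot.2 h).mul_left _)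
  have h1 : s₂.eval 1 ≠ 0 := fun h => hndvd₂ (dvd_iff_isRoot.2 h)
  have heval : ∀ w : ℝ, ((X - C (0:ℝ)) ^ m * ((X - C (1:ℝ)) ^ m' * s₂)).eval w =
      w ^ m * (1 - w) ^ m' * ((-1) ^ m' * s₂.eval w) := by
    intro w
    simp only [Polynomial.eval_mul, Polynomial.eval_pow, Polynomial.eval_sub, Polynomial.eval_X,
      Polynomial.eval_C, sub_zero]
    rw [show w - 1 = -(1 - w) by ring, neg_pow]
    ring
  refine ⟨m, m', C ((-1) ^ m') * s₂, fun w hw => ?_, fun w => by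
    rw [heval, Polynomial.eval_mul, Polynomial.eval_C]⟩
  rw [Polynomial.eval_mul, Polynomial.eval_C]
  refine mul_ne_zero (pow_ne_zero _ (neg_ne_zero.2 one_ne_zero)) ?_
  rcases hw.1.eq_or_lt with h | hw0
  · rw [← h]; exact h0
  rcases hw.2.eq_or_lt with h | hw1
  · rw [h]; exact h1
  intro h
  apply hroot w ⟨hw0, hw1⟩
  rw [heval, h, mul_zero, mul_zero]

/-- **Cube-monomial form in one variable.** If `F(x) = r(x 0)` for a non-zero real polynomial `r`
without roots in `(0, 1)`, then on the open neighbourhood `{s(x 0) ≠ 0}` of the closed unit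
interval `F(x) = (x 0)^m (1 - x 0)^{m'} · s(x 0)` with `s` analytic and nowhere zero there.
[folklore] -/
theorem exists_cubeMono_of_eval {F : (Fin 1 → ℝ) → ℝ} {r : Polynomial ℝ} (hr : r ≠ 0)
    (hF : ∀ x, F x = r.eval (x 0)) (hroot : ∀ w ∈ Ioo (0:ℝ) 1, r.eval w ≠ 0) :
    ∃ U : Set (Fin 1 → ℝ), IsOpen U ∧
      Set.pi Set.univ (fun _ : Fin 1 => Set.Icc (0:ℝ) 1) ⊆ U ∧
      ∃ (a b : Fin 1 → ℕ) (e : (Fin 1 → ℝ) → ℝ), AnalyticOnNhd ℝ e U ∧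
        (∀ x ∈ U, e x ≠ 0) ∧ ∀ x ∈ U, F x = (∏ i, x i ^ a i * (1 - x i) ^ b i) * e x := by
  obtain ⟨m, m', s, hs, heval⟩ := exists_factor_of_forall_eval_ne_zero hr hroot
  refine ⟨{x | s.eval (x 0) ≠ 0},
    isOpen_compl_singleton.preimage (s.continuous.comp (continuous_apply 0)),
    fun x hx => hs (x 0) (mem_univ_pi.1 hx 0), fun _ => m, fun _ => m', fun x => s.eval (x 0),
    fun x _ => ?_, fun x hx => hx, fun x _ => ?_⟩
  · have h := ((ContinuousLinearMap.proj (R := ℝ) (φ := fun _ : Fin 1 => ℝ) 0).analyticAt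
      x).aeval_polynomial (A := ℝ) s
    simpa only [ContinuousLinearMap.proj_apply, Polynomial.coe_aeval_eq_eval] using h
  · rw [hF, heval, Fin.prod_univ_one]

/-- **Stub S2 `stub_cubeMonomializationOne` (`E(1)`; provable now, S–M).** A bounded
`ℚ`-semialgebraic `B ⊆ ℝ¹` is a finite union of points and open intervals with real-algebraic end
points; cutting moreover at the real roots of the `Qⱼ` and parametrising each interval affinely by the
open unit interval, `Qⱼ(a + w(b − a)) = w^{m}(1 − w)^{m'} ·` (a polynomial with no root on `[0,1]`).
[Bochnak–Coste–Roy 1998, §2.1] -/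
theorem stub_cubeMonomializationOne : (∀ (B : Set (Fin 1 → ℝ)), IsSemialgebraic ℚ B → Bornology.IsBounded B → ∀ (k : ℕ) (Q : Fin k → MvPolynomial (Fin 1) ℚ), (∀ j, Q j ≠ 0) → ∃ (N : ℕ) (Φ : Fin N → (Fin 1 → ℝ) → (Fin 1 → ℝ)), (∀ i, (AnalyticOnNhd ℝ (Φ i) (Set.pi Set.univ (fun _ : Fin 1 => Set.Icc (0:ℝ) 1)) ∧ IsSemialgebraicMapOn ℚ (Set.pi Set.univ (fun _ : Fin 1 => Set.Ioo (0:ℝ) 1)) (Φ i) ∧ Set.InjOn (Φ i) (Set.pi Set.univ (fun _ : Fin 1 => Set.Ioo (0:ℝ) 1)) ∧ ∀ x ∈ Set.pi Set.univ (fun _ : Fin 1 => Set.Ioo (0:ℝ) 1), (fderiv ℝ (Φ i) x).det ≠ 0)) ∧ (∀ i, Φ i '' Set.pi Set.univ (fun _ : Fin 1 => Set.Ioo (0:ℝ) 1) ⊆ B) ∧ Pairwise (fun i i' => Disjoint (Φ i '' Set.pi Set.univ (fun _ : Fin 1 => Set.Ioo (0:ℝ) 1)) (Φ i' '' Set.pi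 Set.univ (fun _ : Fin 1 => Set.Ioo (0:ℝ) 1))) ∧ MeasureTheory.volume (B \ ⋃ i, Φ i '' Set.pi Set.univ (fun _ : Fin 1 => Set.Ioo (0:ℝ) 1)) = 0 ∧ ∀ i j, (∃ U : Set (Fin 1 → ℝ), IsOpen U ∧ Set.pi Set.univ (fun _ : Fin 1 => Set.Icc (0:ℝ) 1) ⊆ U ∧ ∃ (a b : Fin 1 → ℕ) (e : (Fin 1 → ℝ) → ℝ), AnalyticOnNhd ℝ e U ∧ (∀ x ∈ U, e x ≠ 0) ∧ ∀ x ∈ U, (fun x => MvPolynomial.aeval (Φ i x) (Q j)) x = (∏ i, x i ^ a i * (1 - x i) ^ b i) * e x)) := by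
  classical
  intro B hB hBb k Q hQ
  -- (1) a cylindrical decomposition of the line, sign-invariant for the polynomials describing `B`
  -- and for the `Q j`
  obtain ⟨QB, T, hBT⟩ := hB.exists_eq_setOf_signVec_mem
  obtain ⟨𝒮, hcd, hsign⟩ :=
    exists_isCylindricalDecomposition_forall_sign_eq (k := ℚ) 1 (QB ∪ Finset.univ.image Q)
  have hpart := hcd.isPartition
  have hcellB : ∀ S ∈ 𝒮, ∀ x ∈ S, x ∈ B → S ⊆ B := by
    intro S hS x hxS hxB y hyS
    rw [hBT] at hxB ⊢
    have hfun :
        (fun q : QB => SignType.sign (MvPolynomial.aeval y (q : MvPolynomial (Fin 1) ℚ))) =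
          fun q : QB => SignType.sign (MvPolynomial.aeval x (q : MvPolynomial (Fin 1) ℚ)) :=
      funext fun q => hsign S hS q (Finset.mem_union_left _ q.2) y hyS x hxS
    show (fun q : QB => SignType.sign (MvPolynomial.aeval y (q : MvPolynomial (Fin 1) ℚ))) ∈ T
    rw [hfun]
    exact hxB
  have hsignQ : ∀ S ∈ 𝒮, ∀ j, ∀ x ∈ S, ∀ y ∈ S,
      SignType.sign (MvPolynomial.aeval x (Q j)) = SignType.sign (MvPolynomial.aeval y (Q j)) :=
    fun S hS j x hx y hy => hsign S hS (Q j)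
      (Finset.mem_union_right _ (Finset.mem_image_of_mem Q (Finset.mem_univ j))) x hx y hy
  -- (2) `B` is bounded in the coordinate `x 0`; the open unit interval is semialgebraic
  obtain ⟨R, hR⟩ : ∃ R : ℝ, ∀ x ∈ B, |x 0| ≤ R := by
    obtain ⟨R, hR⟩ := hBb.subset_closedBall 0
    refine ⟨R, fun x hx => ?_⟩
    have h := hR hx
    rw [Metric.mem_closedBall, dist_zero_right] at h
    have h' := (norm_le_pi_norm x 0).trans h
    rwa [Real.norm_eq_abs] at h'
  have hIoo01 : IsSemialgebraic ℚ (Set.pi Set.univ fun _ : Fin 1 => Set.Ioo (0:ℝ) 1) := by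
    convert isSemialgebraic_unitInterval_fin_one using 1
    ext x
    simp [Fin.forall_fin_one]
  -- (3) the cells of positive length inside `B`: bounded open intervals with algebraic end points
  obtain ⟨𝒞, hmem𝒞⟩ :
      ∃ 𝒞 : Finset (Set (Fin 1 → ℝ)), ∀ S, S ∈ 𝒞 ↔ S ∈ 𝒮 ∧ S ⊆ B ∧ volume S ≠ 0 :=
    ⟨𝒮.filter fun S => S ⊆ B ∧ volume S ≠ 0, fun S => Finset.mem_filter⟩
  obtain ⟨N, ⟨e⟩⟩ : ∃ N : ℕ, Nonempty (𝒞 ≃ Fin N) := ⟨_, ⟨𝒞.equivFin⟩⟩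
  have h𝒮e : ∀ i, (e.symm i).1 ∈ 𝒮 := fun i => ((hmem𝒞 _).1 (e.symm i).2).1
  have hIoo : ∀ i : Fin N, ∃ c c' : ℝ, c < c' ∧ IsAlgebraic ℚ c ∧ IsAlgebraic ℚ c' ∧
      (e.symm i).1 = {z | z 0 ∈ Ioo c c'} := fun i => by
    obtain ⟨hC𝒮, hCB, hCvol⟩ := (hmem𝒞 _).1 (e.symm i).2
    exact exists_eq_Ioo_of_isCylindricalDecomposition_one hcd hC𝒮 hCvol
      ⟨R, fun x hx => hR x (hCB hx)⟩
  choose c c' hlt hc hc' hCeq using hIoo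
  -- (4) the charts `x ↦ c i + (c' i - c i) • x`
  refine ⟨N, fun i x => (fun _ : Fin 1 => c i) + (c' i - c i) • x,
    fun i => ⟨fun x _ => analyticAt_affine _ _ x,
      isSemialgebraicMapOn_affine (hc i) ((hc' i).sub (hc i)) hIoo01,
      (affine_injective _ (sub_ne_zero.2 (hlt i).ne')).injOn, fun x _ => ?_⟩,
    fun i => ?_, ?_, ?_, fun i j => ?_⟩
  · -- Jacobian
    rw [(hasFDerivAt_affine _ _ x).fderiv,
      HermiteRigidity.GenusTwoCycleTransfer.det_smul_id_fin_one]
    exact sub_ne_zero.2 (hlt i).ne'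
  · -- images inside `B`
    rw [image_affine (hlt i), ← hCeq]
    exact ((hmem𝒞 _).1 (e.symm i).2).2.1
  · -- pairwise disjoint images
    intro i i' hii'
    rw [image_affine (hlt i), image_affine (hlt i'), ← hCeq, ← hCeq]
    have hne : (e.symm i).1 ≠ (e.symm i').1 := fun h => hii' (e.symm.injective (Subtype.ext h))
    exact hpart.pairwiseDisjoint (Finset.mem_coe.2 (h𝒮e i)) (Finset.mem_coe.2 (h𝒮e i')) hne
  · -- the complement of the images in `B` is covered by the null cells
    have hcover :
        B \ ⋃ i, (fun x : Fin 1 → ℝ => (fun _ : Fin 1 => c i) + (c' i - c i) • x) ''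
          Set.pi Set.univ (fun _ : Fin 1 => Set.Ioo (0:ℝ) 1) ⊆
        ⋃₀ (↑(𝒮.filter fun S => volume S = 0) : Set (Set (Fin 1 → ℝ))) := by
      rintro x ⟨hxB, hxU⟩
      obtain ⟨S, ⟨hS, hxS⟩, -⟩ := hpart.2 x
      have hS' : S ∈ 𝒮 := Finset.mem_coe.1 hS
      by_cases hvol : volume S = 0
      · exact mem_sUnion_of_mem hxS (Finset.mem_coe.2 (Finset.mem_filter.2 ⟨hS', hvol⟩))
      · exfalso
        refine hxU (mem_iUnion.2
          ⟨e ⟨S, (hmem𝒞 S).2 ⟨hS', hcellB S hS' x hxS hxB, hvol⟩⟩, ?_⟩)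
        rw [image_affine (hlt _), ← hCeq, Equiv.symm_apply_apply]
        exact hxS
    refine measure_mono_null hcover ((measure_sUnion_null_iff (Finset.countable_toSet _)).2 ?_)
    exact fun S hS => (Finset.mem_filter.1 (Finset.mem_coe.1 hS)).2
  · -- (5) cube-monomialization of `Q j` along the chart `i`
    have hL : 0 < c' i - c i := sub_pos.2 (hlt i)
    have hmemC :
        ∀ w ∈ Ioo (0:ℝ) 1, (fun _ : Fin 1 => c i + (c' i - c i) * w) ∈ (e.symm i).1 := by
      intro w hw
      rw [hCeq]
      simp only [mem_setOf_eq, mem_Ioo]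
      constructor <;> nlinarith [hw.1, hw.2]
    set r : Polynomial ℝ := MvPolynomial.aeval
      (fun _ : Fin 1 => Polynomial.C (c i) + Polynomial.C (c' i - c i) * Polynomial.X) (Q j)
      with hr_def
    have hr : r ≠ 0 := aeval_line_ne_zero _ hL.ne' (hQ j)
    have hroot : ∀ w ∈ Ioo (0:ℝ) 1, r.eval w ≠ 0 := by
      intro w hw h0
      apply hr
      refine Polynomial.eq_zero_of_infinite_isRoot _
        ((Set.Ioo_infinite (show (0:ℝ) < 1 by norm_num)).mono fun w' hw' => ?_)
      show r.eval w' = 0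
      have key := hsignQ _ (h𝒮e i) j _ (hmemC w' hw') _ (hmemC w hw)
      rw [hr_def, eval_aeval_line] at h0 ⊢
      rw [h0, sign_zero, sign_eq_zero_iff] at key
      exact key
    have hF : ∀ x : Fin 1 → ℝ,
        MvPolynomial.aeval ((fun _ : Fin 1 => c i) + (c' i - c i) • x) (Q j) = r.eval (x 0) :=
      fun x => by
      rw [affine_eq, hr_def, eval_aeval_line]
    exact exists_cubeMono_of_eval hr hF hroot

end Summit.KontsevichZagierPeriods.SymplecticScissors.CubeNashNormalFormCubeMonomializationOne

end
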